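import Summits.Ventures.AbcSig.Rows.StatementsC1b
import Summits.Ventures.AbcSig.Rows.XnYn23Z2EvenXCell

/-!
# Venture AbcSig — p1's named statement `Rows.C1C23EvenV2Signed` ASSEMBLED from the landed cell theorems (GENERATED by p-lean g5 `gen5/conj.py`)

HONEST FRAMING. COMPUTATION cell `pub-abcsig`; CONDITIONAL theorem; no claim on ABC or any summit. This file only composes:
p1's `Rows.C1C23EvenV2Signed` (:= `Rows.C1CellEven 23 11 ∅`; row of record census/rows/C1/C1-C23-even.md (v2)) is definitionally the conclusion of the cell theorem used; this file gives it the ledger's name.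
Hypotheses = the UNION of the cells' hypotheses verbatim (a binder name used by two cells with different statements carries a suffix `_2`, `_3`, …):
`BS04Package` (CITED), `EisPackage` / `EisChiPackage` where a cell discharges a module certificate in the kernel (CITED recipes), `DataComplete` at the
levels [1058] + the `Refines…` of kernel module certificates (COMPUTED), and 1 per-orbit CITED exclusions `hX_…`.
Where the named statement uses p1's UNREDUCED predicate `Rows.C2aCell` (all `m ≥ 1` with `n ∤ m`), the reduced cell (`Rows.C2aCellRed`, RULING H1) is
transported by the n-th-power absorption bridge `C2aCell_of_red` of `Rows/BridgeRed.lean` (bounded 2-exponent classes only).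
Cells used: `C1CellEven_23_of` (XnYn23Z2EvenXCell.lean).
-/

namespace Summit.Ventures.AbcSig

/-- **`Rows.C1C23EvenV2Signed`** from the cell theorems (hypotheses = union of theirs). -/
theorem C1C23EvenV2Signed_of (M : NewformModel) (hP : M.BS04Package)
    (hE : M.EisPackage) (hEχ : M.EisChiPackage)
    (hK11 : M.RefinedTraces (fun S => S.A = 1 ∧ S.B = 1 ∧ S.C = 23 ∧ S.n = 11 ∧ 2 ∣ S.a * S.b) krausTab_C23e_n11)
    (hD1058 : M.DataComplete 1058 level1058Orbits) (hRc_orbit_1058_10 : M.Refines 1058 orbit_1058_10 m6chiX_1058_10)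
    (hRp_orbit_1058_11 : M.Refines 1058 orbit_1058_11 m6pX_1058_11) (hRk_orbit_1058_12 : M.Refines 1058 orbit_1058_12 m4kX_1058_12)
    (hRk_orbit_1058_13 : M.Refines 1058 orbit_1058_13 m4kX_1058_13)
    (hX_orbit_1058_3 : ∀ n : ℕ, M.Excludes 1058 orbit_1058_3 (fun S => S.A = 1 ∧ S.B = 1 ∧ S.C = 23 ∧ S.n = n ∧ 2 ∣ S.a * S.b)) :
    Rows.C1C23EvenV2Signed :=
  (C1CellEven_23_of M hP hE hEχ hK11 hD1058 hRc_orbit_1058_10 hRp_orbit_1058_11 hRk_orbit_1058_12 hRk_orbit_1058_13 hX_orbit_1058_3)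

end Summit.Ventures.AbcSig
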